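import Literature.NumberTheory.QuadraticFields.ThreeTorsionMeanLocalAtThree
import Literature.NumberTheory.QuadraticFields.ThreeTorsionMeanProgressionMean
import Literature.NumberTheory.QuadraticFields.SquarefreeModFour
import HarnessLib

/-!
# Davenport–Heilbronn with a local condition at `3`: the discriminant counts (proofs)

Theorems-only companion of `ThreeTorsionMeanLocalAtThree.lean`: it DISCHARGES the named fact
`bv_count_posFundDiscrs_localAtThree` (Bhargava–Varma 2016, Lemma 37 (a), for the two local
specifications `Σ₃ = {3 ramified}`, `Σ₃ = {3 unramified}` at the single prime `3`): the numbers of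
positive fundamental discriminants `0 < D < X` with `3 ∣ D`, resp. `3 ∤ D`, are `c X + o(X)` with
`c > 0`.

The source (arXiv:1401.5875, §5.3, Lemma 37, attributed to Bhargava's mass formulae [Bhamass1])
prints no proof ("the following elementary lemma counting quadratic orders"). We do not go through
mass formulae: the tree already holds the EFFECTIVE counts of fundamental discriminants in
arithmetic progressions (Taniguchi–Thorne 2013, Lemma 21 / §6.1, proved in
`ThreeTorsionMeanProgressionCountPos.lean`),
`|#{D ∈ posFundDiscrs X : D ≡ a (mod m)} − (3/(π² m)) Π_{p ∣ m} (1 − p⁻²)⁻¹ X| ≤ 18 √X` for `m` odd,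
`gcd(a, m) = 1`, and the unrestricted count `|#posFundDiscrs X − (3/π²) X| ≤ 8 √X`
(`ThreeTorsionMeanProofs.lean`; limit form `tendsto_card_posFundDiscrs_div` in
`SquarefreeModFour.lean`). Hence

* `#{D : D ≡ 1 (3)}/X`, `#{D : D ≡ 2 (3)}/X → 9/(8π²)` each, so `#{D : 3 ∤ D}/X → 9/(4π²) = (3/π²)·(3/4)`;
* `#{D : 3 ∣ D}/X = #posFundDiscrs X/X − #{D : 3 ∤ D}/X → 3/π² − 9/(4π²) = 3/(4π²) = (3/π²)·(1/4)`,

which are exactly the Euler-product constants of Lemma 37 (a) for these two `Σ` (local factor at `3`: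
`(2/3)·(1/3)·(1/2)·… `, see the docstring of the fact), and both are positive.

## Also here: the effective counts, and the assembly of Bhargava–Varma §5.3 at the prime `3`

Towards the OTHER fact of `ThreeTorsionMeanLocalAtThree.lean`, `bv_threeTorsion_mean_localAtThree`
(Cor. 4 (b) at `3`). Its printed proof (§5.4 = Thm 3 of §5.3 plus `M_Σ = 1`, Lemma 38) assembles,
in the last display of §5.3, four inputs: (1) `2·N^{(i)}(X, Σ) = Σ_{𝒪 ∈ Σ, 0<(-1)^i Disc 𝒪<X} (#Cl₃(𝒪) − 1)`
(display (5.2); Prop. 35, ring class fields — for maximal orders Hasse's bijection between cubic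
fields of discriminant `D` and index-`3` subgroups of `Cl(ℚ(√D))`: CLASS FIELD THEORY, neither in
Mathlib nor in the tree, cf. `CubicFields/ThreeTorsionBridge.lean` where it is likewise a
hypothesis); (2) Thm 36 ([BST]): the count `N₃(Σ³, X) = (½ Σ_∞ 1/|Aut|) Π_p (…) X + o(X)` of cubic
orders with acceptable local specifications (Davenport's geometry of numbers with congruence
conditions — not in the tree); (3) Lemma 37 (a) (this file); (4) Lemma 38, `C(R) = ½` for maximal
`R`. Proved here, bottom-up along that architecture:

* `abs_card_posFundDiscrs_filter_not_three_dvd_sub_le`, `abs_card_posFundDiscrs_filter_three_dvd_sub_le`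
  — input (3) with explicit error terms: `|#{3 ∤ D} − (9/(4π²)) X| ≤ 36 √X`,
  `|#{3 ∣ D} − (3/(4π²)) X| ≤ 44 √X` (`X ≥ 1`);
* `tendsto_mean_of_eq_two_mul_add_one` — the last display of §5.3, abstractly: a dictionary
  `t = 2c + 1` on finsets `T X`, `(Σ_{T X} c)/X → A` and `#T X/X → B > 0` give
  `(Σ_{T X} t)/#T X → 1 + 2A/B`;
* `bv_threeTorsion_mean_localAtThree_of_cubicCount` — Cor. 4 (b) at `3` REDUCED to inputs (1)–(2)
  on the quadratic side: for any `c : ℤ → ℕ` with `#Cl₃(D) = 2·c(D) + 1` on positive fundamental `D`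
  (in print `c(D)` = the number of cubic fields of discriminant `D`), the limits
  `(Σ_{0<D<X, 3∣D} c(D))/X → 1/(8π²)` and `(Σ_{0<D<X, 3∤D} c(D))/X → 3/(8π²)` (input (2) through
  (5.1)–(5.3) with `M_Σ = 1`: `(1/(2n₀)) Π_p (…)`, `n₀ = 6`, one sixth of the densities of (3))
  imply `bv_threeTorsion_mean_localAtThree` (`1 + 2·(1/6) = 4/3`);
* `tendsto_sum_div_of_tendsto_mean`, `tendsto_cubicCount_div_of_bv_threeTorsion_mean_localAtThree`
  — conversely, under the same dictionary the fact gives back exactly those two limits (the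
  constants `1/(8π²)`, `3/(8π²)` are forced).

NOT proved (why `bv_threeTorsion_mean_localAtThree` stays a named fact): inputs (1) and (2).

## References
* M. Bhargava, I. Varma, Proc. London Math. Soc. (3) 112 (2016) 235–266 = arXiv:1401.5875, §5.3,
  Lemma 37 (a); Cor. 4, §5.3 (Thm 36, (5.1)–(5.3)), §5.4 (Lemma 38). [BhargavaVarma2016]
* T. Taniguchi, F. Thorne, Duke Math. J. 162 (2013), Lemma 21, §6.1. [TaniguchiThorne2013]
-/

noncomputable section

open Finset Filter
open scoped Topology

namespace Literature.NumberTheory.QuadraticFields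

/-! ### Bookkeeping -/

/-- `|F(X) − A X| ≤ C √X` for `X ≥ 1` gives `F(X)/X → A`. [folklore] -/
theorem tendsto_div_natCast_of_abs_sub_le_sqrt {F : ℕ → ℝ} {A C : ℝ}
    (hF : ∀ X : ℕ, 1 ≤ X → |F X - A * X| ≤ C * Real.sqrt X) :
    Tendsto (fun X : ℕ => F X / X) atTop (𝓝 A) := by
  refine tendsto_div_natCast_of_abs_sub_le (c₁ := C) (c₂ := 0) (θ₁ := 1 / 2) (θ₂ := 0)
    (by norm_num) (by norm_num) fun X hX => ?_
  rw [zero_mul, add_zero, ← Real.sqrt_eq_rpow]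
  exact hF X hX

/-! ### The two classes `1, 2 (mod 3)` -/

/-- For `gcd(a, 3) = 1`: `#{D ∈ posFundDiscrs X : D ≡ a (mod 3)}/X → 9/(8π²)`
(`= (3/(3π²)) · (1 − 3⁻²)⁻¹`, Taniguchi–Thorne's progression count at `m = 3`).
[cite: TaniguchiThorne2013, Lemma 21 and §6.1] -/
theorem tendsto_card_posFundDiscrs_modEq_three_div {a : ℤ} (ha : Int.gcd a 3 = 1) :
    Tendsto (fun X : ℕ =>
      (((posFundDiscrs X).filter (fun D => D ≡ a [ZMOD ((3 : ℕ) : ℤ)])).card : ℝ) / X)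
      atTop (𝓝 (9 / (8 * Real.pi ^ 2))) := by
  have h3 : Odd 3 := ⟨1, rfl⟩
  have hcoef : 3 / (Real.pi ^ 2 * ((3 : ℕ) : ℝ)) *
      (∏ p ∈ (3 : ℕ).primeFactors, (1 - 1 / (p : ℝ) ^ 2)⁻¹) = 9 / (8 * Real.pi ^ 2) := by
    rw [Nat.Prime.primeFactors Nat.prime_three, Finset.prod_singleton]
    push_cast
    have hπ : Real.pi ^ 2 ≠ 0 := by positivity
    field_simp
    norm_num
  refine tendsto_div_natCast_of_abs_sub_le_sqrt (C := 18) fun X hX => ?_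
  have key := abs_card_posFundDiscrs_filter_modEq_sub_le (m := 3) h3 ha hX
  rw [hcoef] at key
  simpa only [Nat.cast_id] using key

/-- `#{D ∈ posFundDiscrs X : 3 ∤ D} = #{D ≡ 1 (mod 3)} + #{D ≡ 2 (mod 3)}`. [folklore] -/
theorem card_posFundDiscrs_filter_not_three_dvd (X : ℕ) :
    ((posFundDiscrs X).filter (fun D => ¬ (3 : ℤ) ∣ D)).card =
      ((posFundDiscrs X).filter (fun D => D ≡ 1 [ZMOD ((3 : ℕ) : ℤ)])).card +
      ((posFundDiscrs X).filter (fun D => D ≡ 2 [ZMOD ((3 : ℕ) : ℤ)])).card := by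
  rw [← Finset.card_union_of_disjoint, ← Finset.filter_or]
  · congr 1
    refine Finset.filter_congr fun D _ => ?_
    simp only [Int.ModEq, Nat.cast_ofNat]
    omega
  · rw [Finset.disjoint_filter]
    intro D _ h1 h2
    simp only [Int.ModEq, Nat.cast_ofNat] at h1 h2
    omega

/-- `#{D ∈ posFundDiscrs X : 3 ∤ D}/X → 9/(4π²) = (3/π²)·(3/4)`. [cite: BhargavaVarma2016, Lemma 37 (a)] -/
theorem tendsto_card_posFundDiscrs_not_three_dvd_div :
    Tendsto (fun X : ℕ =>
      (((posFundDiscrs X).filter (fun D => ¬ (3 : ℤ) ∣ D)).card : ℝ) / X)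
      atTop (𝓝 (9 / (4 * Real.pi ^ 2))) := by
  have h1 := tendsto_card_posFundDiscrs_modEq_three_div (a := 1) (by decide)
  have h2 := tendsto_card_posFundDiscrs_modEq_three_div (a := 2) (by decide)
  have h12 := h1.add h2
  rw [show 9 / (8 * Real.pi ^ 2) + 9 / (8 * Real.pi ^ 2) = 9 / (4 * Real.pi ^ 2) by ring] at h12
  refine h12.congr fun X => ?_
  rw [card_posFundDiscrs_filter_not_three_dvd, Nat.cast_add, add_div]

/-- `#{D ∈ posFundDiscrs X : 3 ∣ D}/X → 3/(4π²) = (3/π²)·(1/4)` (total density `3/π²`,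
`tendsto_card_posFundDiscrs_div`, minus that of `3 ∤ D`). [cite: BhargavaVarma2016, Lemma 37 (a)] -/
theorem tendsto_card_posFundDiscrs_three_dvd_div :
    Tendsto (fun X : ℕ =>
      (((posFundDiscrs X).filter (fun D => (3 : ℤ) ∣ D)).card : ℝ) / X)
      atTop (𝓝 (3 / (4 * Real.pi ^ 2))) := by
  have h := tendsto_card_posFundDiscrs_div.sub tendsto_card_posFundDiscrs_not_three_dvd_div
  rw [show 3 / Real.pi ^ 2 - 9 / (4 * Real.pi ^ 2) = 3 / (4 * Real.pi ^ 2) by ring] at h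
  refine h.congr fun X => ?_
  have hsplit := Finset.card_filter_add_card_filter_not (s := posFundDiscrs X)
    (fun D => (3 : ℤ) ∣ D)
  rw [← sub_div, ← hsplit, Nat.cast_add, add_sub_cancel_right]

/-! ### The discharge -/

/-- **Bhargava–Varma 2016, Lemma 37 (a) at the prime `3`, discharged**: the positive fundamental
discriminants with `3 ∣ D`, resp. `3 ∤ D`, have positive densities (`3/(4π²)`, resp. `9/(4π²)`).
[cite: BhargavaVarma2016, Lemma 37 (a)] -/
theorem bv_count_posFundDiscrs_localAtThree_holds : bv_count_posFundDiscrs_localAtThree :=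
  ⟨⟨3 / (4 * Real.pi ^ 2), by positivity, tendsto_card_posFundDiscrs_three_dvd_div⟩,
    ⟨9 / (4 * Real.pi ^ 2), by positivity, tendsto_card_posFundDiscrs_not_three_dvd_div⟩⟩

/-! ### Lemma 37 (a) at the prime `3` with explicit error terms `O(√X)` -/

/-- The main-term constant of `abs_card_posFundDiscrs_filter_modEq_sub_le` at `m = 3`:
`(3/(π²·3)) · (1 − 3⁻²)⁻¹ = 9/(8π²)`. [folklore] -/
theorem three_div_mul_prod_primeFactors_three :
    3 / (Real.pi ^ 2 * ((3 : ℕ) : ℝ)) * (∏ p ∈ (3 : ℕ).primeFactors, (1 - 1 / (p : ℝ) ^ 2)⁻¹) =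
      9 / (8 * Real.pi ^ 2) := by
  rw [Nat.Prime.primeFactors Nat.prime_three, Finset.prod_singleton]
  have hpi : Real.pi ≠ 0 := Real.pi_ne_zero
  push_cast
  field_simp
  norm_num

/-- **Lemma 37 (a) of Bhargava–Varma at `Σ₃ = {3 unramified}`, effective form**: for `X ≥ 1`,
`|#{0 < D < X fundamental : 3 ∤ D} − (9/(4π²)) X| ≤ 36 √X` (printed constant
`½ · Π_p (…) = (3/π²) · (3/4)`; from the counts `(9/(8π²)) X + O(18√X)` in the two classes
`1, 2 (mod 3)`). [cite: BhargavaVarma2016, Lemma 37 (a)] -/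
theorem abs_card_posFundDiscrs_filter_not_three_dvd_sub_le {X : ℕ} (hX : 1 ≤ X) :
    |((((posFundDiscrs X).filter (fun D => ¬ (3 : ℤ) ∣ D)).card : ℕ) : ℝ)
        - 9 / (4 * Real.pi ^ 2) * X| ≤ 36 * Real.sqrt X := by
  have h3 : Odd (3 : ℕ) := ⟨1, rfl⟩
  have e₁ := abs_card_posFundDiscrs_filter_modEq_sub_le (m := 3) h3 (a := 1) (by decide) hX
  have e₂ := abs_card_posFundDiscrs_filter_modEq_sub_le (m := 3) h3 (a := 2) (by decide) hX
  rw [three_div_mul_prod_primeFactors_three] at e₁ e₂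
  rw [card_posFundDiscrs_filter_not_three_dvd, Nat.cast_add]
  push_cast at e₁ e₂ ⊢
  have key : ((((posFundDiscrs X).filter (fun D => D ≡ 1 [ZMOD 3])).card : ℝ)
      + (((posFundDiscrs X).filter (fun D => D ≡ 2 [ZMOD 3])).card : ℝ))
      - 9 / (4 * Real.pi ^ 2) * X =
      ((((posFundDiscrs X).filter (fun D => D ≡ 1 [ZMOD 3])).card : ℝ) - 9 / (8 * Real.pi ^ 2) * X)
      + ((((posFundDiscrs X).filter (fun D => D ≡ 2 [ZMOD 3])).card : ℝ)
          - 9 / (8 * Real.pi ^ 2) * X) := by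
    ring
  rw [key]
  refine (abs_add_le _ _).trans ?_
  linarith

/-- **Lemma 37 (a) of Bhargava–Varma at `Σ₃ = {3 ramified}`, effective form**: for `X ≥ 1`,
`|#{0 < D < X fundamental : 3 ∣ D} − (3/(4π²)) X| ≤ 44 √X` (printed constant
`½ · Π_p (…) = (3/π²) · (1/4)`; the complement of the unramified count in the PROVED total
`#posFundDiscrs X = (3/π²) X + O(8√X)`, `abs_card_posFundDiscrs_sub_le`).
[cite: BhargavaVarma2016, Lemma 37 (a)] -/
theorem abs_card_posFundDiscrs_filter_three_dvd_sub_le {X : ℕ} (hX : 1 ≤ X) :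
    |((((posFundDiscrs X).filter (fun D => (3 : ℤ) ∣ D)).card : ℕ) : ℝ)
        - 3 / (4 * Real.pi ^ 2) * X| ≤ 44 * Real.sqrt X := by
  have hsplit := Finset.card_filter_add_card_filter_not (s := posFundDiscrs X)
    (fun D => (3 : ℤ) ∣ D)
  have hcast : ((((posFundDiscrs X).filter (fun D => (3 : ℤ) ∣ D)).card : ℕ) : ℝ) =
      ((posFundDiscrs X).card : ℝ)
        - ((((posFundDiscrs X).filter (fun D => ¬ (3 : ℤ) ∣ D)).card : ℕ) : ℝ) := by
    have h := congrArg (Nat.cast (R := ℝ)) hsplit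
    push_cast at h ⊢
    linarith
  have e₁ := abs_card_posFundDiscrs_sub_le X
  have e₂ := abs_card_posFundDiscrs_filter_not_three_dvd_sub_le hX
  rw [hcast]
  have key : ((posFundDiscrs X).card : ℝ)
      - ((((posFundDiscrs X).filter (fun D => ¬ (3 : ℤ) ∣ D)).card : ℕ) : ℝ)
      - 3 / (4 * Real.pi ^ 2) * X =
      (((posFundDiscrs X).card : ℝ) - 3 / Real.pi ^ 2 * X)
      - (((((posFundDiscrs X).filter (fun D => ¬ (3 : ℤ) ∣ D)).card : ℕ) : ℝ)
          - 9 / (4 * Real.pi ^ 2) * X) := by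
    ring
  rw [key]
  refine (abs_sub _ _).trans ?_
  linarith

/-! ### The assembly of §5.3 (its last display), abstractly and at the prime `3` -/

/-- **Bhargava–Varma §5.3, last display, abstract form.** On finsets `T X` (in print: the
`Σ`-orders `𝒪` with `0 < (-1)^i Disc 𝒪 < X`), let the statistic `t` and the count `c` satisfy
`t = 2c + 1` (in print (5.2): `2·N^{(i)}(X, Σ) = Σ (#Cl₃(𝒪) − 1)`), let `(Σ_{T X} c)/X → A`
(the limit `lim N^{(i)}(X, Σ)/X` of (5.1)) and `#T X / X → B` with `B > 0` (Lemma 37). Then the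
mean `(Σ_{T X} t)/#T X` tends to `1 + 2A/B`.
[cite: BhargavaVarma2016, §5.3 (proof of Thm 3, last display)] -/
theorem tendsto_mean_of_eq_two_mul_add_one {T : ℕ → Finset ℤ} {t c : ℤ → ℕ} {A B : ℝ}
    (htc : ∀ X : ℕ, ∀ D ∈ T X, t D = 2 * c D + 1)
    (hA : Tendsto (fun X : ℕ => (∑ D ∈ T X, (c D : ℝ)) / (X : ℝ)) atTop (𝓝 A))
    (hB : 0 < B) (hTB : Tendsto (fun X : ℕ => ((T X).card : ℝ) / (X : ℝ)) atTop (𝓝 B)) :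
    Tendsto (fun X : ℕ => (∑ D ∈ T X, (t D : ℝ)) / ((T X).card : ℝ)) atTop
      (𝓝 (1 + 2 * A / B)) := by
  -- `Σ t = 2 Σ c + #T`
  have hsum : ∀ X : ℕ, (∑ D ∈ T X, (t D : ℝ)) = 2 * (∑ D ∈ T X, (c D : ℝ)) + ((T X).card : ℝ) := by
    intro X
    rw [Finset.card_eq_sum_ones, Nat.cast_sum, Finset.mul_sum, ← Finset.sum_add_distrib]
    refine Finset.sum_congr rfl fun D hD => ?_
    rw [htc X D hD]
    push_cast
    ring
  -- `(Σ t)/X → 2A + B`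
  have h1 : Tendsto (fun X : ℕ => (∑ D ∈ T X, (t D : ℝ)) / (X : ℝ)) atTop (𝓝 (2 * A + B)) := by
    refine ((hA.const_mul 2).add hTB).congr fun X => ?_
    rw [hsum X]
    ring
  have h2 := h1.div hTB hB.ne'
  rw [show (2 * A + B) / B = 1 + 2 * A / B by field_simp; ring] at h2
  refine h2.congr' ?_
  filter_upwards [eventually_ge_atTop 1] with X hX
  have hX0 : (X : ℝ) ≠ 0 := by positivity
  exact div_div_div_cancel_right₀ hX0 _ _

/-- **Bhargava–Varma, Cor. 4 (b) at the prime `3`, reduced to its two deep inputs.** Let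
`c : ℤ → ℕ` satisfy the dictionary `#Cl₃(D) = 2·c(D) + 1` on positive fundamental discriminants
(display (5.2) for maximal orders, i.e. Prop. 35 / Hasse's class-field-theoretic bijection; in print
`c(D)` = the number of cubic fields of discriminant `D`; its group-theoretic half is
`quadFieldThreeTorsion_eq_two_mul_card_index_three_add_one`). If
`(Σ_{0<D<X, 3 ∣ D} c(D))/X → 1/(8π²)` and `(Σ_{0<D<X, 3 ∤ D} c(D))/X → 3/(8π²)` (Thm 36 through
(5.1)–(5.3) with `M_Σ = 1` by Lemma 38: `lim N^{(0)}(X, Σ)/X = (1/(2n₀)) Π_p (…)`, `n₀ = 6`, one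
sixth of the densities `3/(4π²)`, `9/(4π²)` of Lemma 37 (a) proved above), then the named fact
`bv_threeTorsion_mean_localAtThree` holds: each mean tends to `1 + 2·(1/6) = 4/3`.
[cite: BhargavaVarma2016, §5.3–5.4 (proof of Cor. 4)] -/
theorem bv_threeTorsion_mean_localAtThree_of_cubicCount {c : ℤ → ℕ}
    (hc : ∀ X : ℕ, ∀ D ∈ posFundDiscrs X, quadFieldThreeTorsion D = 2 * c D + 1)
    (hram : Tendsto (fun X : ℕ =>
      (∑ D ∈ (posFundDiscrs X).filter (fun D => (3 : ℤ) ∣ D), (c D : ℝ)) / (X : ℝ))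
      atTop (𝓝 (1 / (8 * Real.pi ^ 2))))
    (hunr : Tendsto (fun X : ℕ =>
      (∑ D ∈ (posFundDiscrs X).filter (fun D => ¬ (3 : ℤ) ∣ D), (c D : ℝ)) / (X : ℝ))
      atTop (𝓝 (3 / (8 * Real.pi ^ 2)))) :
    bv_threeTorsion_mean_localAtThree := by
  have hpi : Real.pi ≠ 0 := Real.pi_ne_zero
  constructor
  · have h := tendsto_mean_of_eq_two_mul_add_one
      (T := fun X : ℕ => (posFundDiscrs X).filter (fun D => (3 : ℤ) ∣ D))
      (t := quadFieldThreeTorsion) (c := c)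
      (fun X D hD => hc X D (Finset.mem_of_mem_filter D hD)) hram
      (by positivity : (0 : ℝ) < 3 / (4 * Real.pi ^ 2))
      (by simpa using tendsto_card_posFundDiscrs_three_dvd_div)
    rwa [show 1 + 2 * (1 / (8 * Real.pi ^ 2)) / (3 / (4 * Real.pi ^ 2)) = (4 / 3 : ℝ) by
      field_simp; norm_num] at h
  · have h := tendsto_mean_of_eq_two_mul_add_one
      (T := fun X : ℕ => (posFundDiscrs X).filter (fun D => ¬ (3 : ℤ) ∣ D))
      (t := quadFieldThreeTorsion) (c := c)
      (fun X D hD => hc X D (Finset.mem_of_mem_filter D hD)) hunr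
      (by positivity : (0 : ℝ) < 9 / (4 * Real.pi ^ 2))
      (by simpa using tendsto_card_posFundDiscrs_not_three_dvd_div)
    rwa [show 1 + 2 * (3 / (8 * Real.pi ^ 2)) / (9 / (4 * Real.pi ^ 2)) = (4 / 3 : ℝ) by
      field_simp; norm_num] at h

/-! ### Conversely: the fact determines the cubic counts (consistency of the constants) -/

/-- **The last display of §5.3 read backwards.** With `t = 2c + 1` on `T X`, if the mean
`(Σ_{T X} t)/#T X → m` and `#T X / X → B`, then `(Σ_{T X} c)/X → (m − 1)·B/2`
(`Σ c = (Σ t − #T)/2`). [cite: BhargavaVarma2016, §5.3 (proof of Thm 3, last display)] -/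
theorem tendsto_sum_div_of_tendsto_mean {T : ℕ → Finset ℤ} {t c : ℤ → ℕ} {m B : ℝ}
    (htc : ∀ X : ℕ, ∀ D ∈ T X, t D = 2 * c D + 1)
    (hm : Tendsto (fun X : ℕ => (∑ D ∈ T X, (t D : ℝ)) / ((T X).card : ℝ)) atTop (𝓝 m))
    (hTB : Tendsto (fun X : ℕ => ((T X).card : ℝ) / (X : ℝ)) atTop (𝓝 B)) :
    Tendsto (fun X : ℕ => (∑ D ∈ T X, (c D : ℝ)) / (X : ℝ)) atTop (𝓝 ((m - 1) * B / 2)) := by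
  -- `Σ t = 2 Σ c + #T`
  have hsum : ∀ X : ℕ, (∑ D ∈ T X, (t D : ℝ)) = 2 * (∑ D ∈ T X, (c D : ℝ)) + ((T X).card : ℝ) := by
    intro X
    rw [Finset.card_eq_sum_ones, Nat.cast_sum, Finset.mul_sum, ← Finset.sum_add_distrib]
    refine Finset.sum_congr rfl fun D hD => ?_
    rw [htc X D hD]
    push_cast
    ring
  have h := ((hm.mul hTB).sub hTB).div_const 2
  rw [show (m * B - B) / 2 = (m - 1) * B / 2 by ring] at h
  refine h.congr fun X => ?_
  rcases eq_or_ne ((T X).card : ℝ) 0 with h0 | h0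
  · have hT : T X = ∅ := Finset.card_eq_zero.1 (by exact_mod_cast h0)
    simp [hT]
  · rw [div_mul_div_cancel₀ h0, hsum X]
    ring

/-- **Conversely, `bv_threeTorsion_mean_localAtThree` pins down the two cubic counts**: under the
dictionary `#Cl₃(D) = 2·c(D) + 1` on positive fundamental discriminants, the fact implies
`(Σ_{0<D<X, 3∣D} c(D))/X → 1/(8π²)` and `(Σ_{0<D<X, 3∤D} c(D))/X → 3/(8π²)`
(`(4/3 − 1)/2 = 1/6` of the densities `3/(4π²)`, `9/(4π²)`), so the hypotheses of
`bv_threeTorsion_mean_localAtThree_of_cubicCount` are exactly as strong as the fact (given the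
dictionary): the translation (5.1)–(5.3) of Cor. 4 (b) at `3` into Thm 36's count of cubic fields
whose quadratic resolvent has `3` ramified, resp. unramified.
[cite: BhargavaVarma2016, §5.3–5.4 (proof of Cor. 4)] -/
theorem tendsto_cubicCount_div_of_bv_threeTorsion_mean_localAtThree {c : ℤ → ℕ}
    (hc : ∀ X : ℕ, ∀ D ∈ posFundDiscrs X, quadFieldThreeTorsion D = 2 * c D + 1)
    (h : bv_threeTorsion_mean_localAtThree) :
    Tendsto (fun X : ℕ =>
      (∑ D ∈ (posFundDiscrs X).filter (fun D => (3 : ℤ) ∣ D), (c D : ℝ)) / (X : ℝ))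
      atTop (𝓝 (1 / (8 * Real.pi ^ 2))) ∧
    Tendsto (fun X : ℕ =>
      (∑ D ∈ (posFundDiscrs X).filter (fun D => ¬ (3 : ℤ) ∣ D), (c D : ℝ)) / (X : ℝ))
      atTop (𝓝 (3 / (8 * Real.pi ^ 2))) := by
  constructor
  · have h1 := tendsto_sum_div_of_tendsto_mean
      (T := fun X : ℕ => (posFundDiscrs X).filter (fun D => (3 : ℤ) ∣ D))
      (t := quadFieldThreeTorsion) (c := c)
      (fun X D hD => hc X D (Finset.mem_of_mem_filter D hD)) h.1
      (by simpa using tendsto_card_posFundDiscrs_three_dvd_div)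
    rwa [show ((4 / 3 : ℝ) - 1) * (3 / (4 * Real.pi ^ 2)) / 2 = 1 / (8 * Real.pi ^ 2) by
      ring] at h1
  · have h2 := tendsto_sum_div_of_tendsto_mean
      (T := fun X : ℕ => (posFundDiscrs X).filter (fun D => ¬ (3 : ℤ) ∣ D))
      (t := quadFieldThreeTorsion) (c := c)
      (fun X D hD => hc X D (Finset.mem_of_mem_filter D hD)) h.2
      (by simpa using tendsto_card_posFundDiscrs_not_three_dvd_div)
    rwa [show ((4 / 3 : ℝ) - 1) * (9 / (4 * Real.pi ^ 2)) / 2 = 3 / (8 * Real.pi ^ 2) by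
      ring] at h2

end Literature.NumberTheory.QuadraticFields

end
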